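import Summits.CriticalPhenomena.SAWScalingLimit.Theorems.HexObservableLimitR.Negative.Mirror
import Summits.CriticalPhenomena.SAWScalingLimit.Theorems.BoundaryClosureR.Negative.NormaliserPin
import Mathlib.Analysis.Calculus.Deriv.Star

/-!
# Negative knowledge on crux `HexObservableLimitR` (stmt-CriticalPhenomena-14003), mirror part 4:
the MIRRORED marked half-disc and its anti-conjugated uniformiser

Support for `ConstReal.lean`.  The half-disc `HD` is invariant under `τ z = -conj z` (`τ_mem_HD_iff`); the
Dobrushin domain `halfDiscDomainNeg r` is `HD` marked `(pt 0, pt 1) = (0, -r)` (the mirror image of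
`halfDiscDomain' r`); the mirrored uniformiser `PsiNeg r : z ↦ τ (Ψ_r (τ z))` is a conformal equivalence
`HD → ℍ` (holomorphic as `conj ∘ (w ↦ -Ψ_r(-w)) ∘ conj`, `differentiableAt_τ_comp`, `hasDerivAt_τ_comp`) with
`0 ↦ ∞` (`tendsto_norm_PsiNeg`) and `-r ↦ 0` (`tendsto_PsiNeg_neg`), and `MfunNeg r = conj ∘ M_r ∘ τ` is a
continuous logarithm of its derivative (`exp_MfunNeg`, `continuousOn_MfunNeg`) with boundary value
`conj (M_r r)` at `-r` (`tendsto_MfunNeg`).  Everything proved. [folklore]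
-/

noncomputable section

open Set Filter Topology Complex Metric
open Literature.Probability.RandomPlanarGeometry
open UpperHalfPlane (upperHalfPlaneSet)
open Literature.Probability.LatticeModels Literature.Probability.RandomPlanarGeometry.SAW

namespace Summit.CriticalPhenomena.SAWScalingLimit.Theorems.HexObservableLimitR.Negative

open BoundaryClosure.Negative BoundaryClosureR.Negative


/-! ### The half-disc is mirror symmetric; the mirrored marked domain -/

/-- `τ` preserves the half-disc. [folklore] -/
theorem τ_mem_HD_iff {z : ℂ} : τ z ∈ HD ↔ z ∈ HD := by
  simp only [HD, mem_setOf_eq, norm_τ, τ_im]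

/-- `τ` maps the half-disc into itself. [folklore] -/
theorem τ_mem_HD {z : ℂ} (hz : z ∈ HD) : τ z ∈ HD := τ_mem_HD_iff.2 hz

/-- **The half-disc marked `(pt 0, pt 1) = (0, -r)`**, `r ∈ (0,1)` (the mirror image of `halfDiscDomain' r`). [folklore] -/
def halfDiscDomainNeg (r : ℝ) (hr : 0 < r ∧ r < 1) : DobrushinDomain where
  toJordanDomain := halfDiscJordan'
  mark := ![0, r / 4]
  strictMono_mark := by
    refine Fin.strictMono_iff_lt_succ.2 fun k => ?_
    fin_cases k
    simp; linarith [hr.1]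
  mark_mem k := by
    fin_cases k
    · simp
    · simp; constructor <;> linarith [hr.1, hr.2]

/-- The carrier of the mirrored marked half-disc is `HD`. [folklore] -/
@[simp] theorem carrier_halfDiscDomainNeg (r : ℝ) (hr : 0 < r ∧ r < 1) : (halfDiscDomainNeg r hr).carrier = HD := rfl

/-- The first marked point of the mirrored half-disc is `0`. [folklore] -/
theorem pt_zero_halfDiscDomainNeg (r : ℝ) (hr : 0 < r ∧ r < 1) : (halfDiscDomainNeg r hr).pt 0 = 0 := by
  show bdry' 0 = 0
  unfold bdry'
  rw [zero_add, bdry_eq_of_mem ⟨by norm_num, by norm_num⟩, bdryFun_of_gt (by norm_num)]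
  push_cast; norm_num

/-- The second marked point of the mirrored half-disc is `-r`. [folklore] -/
theorem pt_one_halfDiscDomainNeg (r : ℝ) (hr : 0 < r ∧ r < 1) : (halfDiscDomainNeg r hr).pt 1 = ((-r : ℝ) : ℂ) := by
  show bdry' (r / 4) = ((-r : ℝ) : ℂ)
  unfold bdry'
  rw [bdry_eq_of_mem ⟨by linarith [hr.1], by linarith [hr.2]⟩, bdryFun_of_gt (by linarith [hr.1])]
  push_cast; ring

/-! ### The anti-conjugated uniformiser `z ↦ τ (Ψ_r (τ z))` -/

/-- `τ` preserves the upper half-plane. [folklore] -/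
theorem τ_mem_upperHalfPlane_iff {w : ℂ} : τ w ∈ upperHalfPlaneSet ↔ w ∈ upperHalfPlaneSet := by
  show 0 < (τ w).im ↔ 0 < w.im
  rw [τ_im]

/-- `z ↦ τ (f (τ z))` is `conj ∘ (w ↦ -f(-w)) ∘ conj`. [folklore] -/
theorem τ_comp_eq (f : ℂ → ℂ) : (fun z => τ (f (τ z))) = (starRingEnd ℂ) ∘ (fun w => -f (-w)) ∘ (starRingEnd ℂ) := by
  funext z; simp [τ]

/-- Differentiability of the anti-conjugate of a holomorphic map at a point. [folklore] -/
theorem differentiableAt_τ_comp {f : ℂ → ℂ} {z : ℂ} (hf : DifferentiableAt ℂ f (τ z)) :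
    DifferentiableAt ℂ (fun z => τ (f (τ z))) z := by
  rw [τ_comp_eq]
  have hg : DifferentiableAt ℂ (fun w => -f (-w)) ((starRingEnd ℂ) z) := by
    refine (DifferentiableAt.comp _ ?_ differentiableAt_id.neg).neg
    simpa [τ] using hf
  simpa using hg.conj_conj

/-- The derivative of the anti-conjugate: `(τ ∘ f ∘ τ)' z = conj (f' (τ z))`. [folklore] -/
theorem hasDerivAt_τ_comp {f : ℂ → ℂ} {f' z : ℂ} (hf : HasDerivAt f f' (τ z)) :
    HasDerivAt (fun z => τ (f (τ z))) ((starRingEnd ℂ) f') z := by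
  rw [τ_comp_eq]
  have hg : HasDerivAt (fun w => -f (-w)) f' ((starRingEnd ℂ) z) := by
    have h1 : HasDerivAt (fun w => f (-w)) (f' * (-1)) ((starRingEnd ℂ) z) := by
      refine HasDerivAt.comp _ ?_ (hasDerivAt_neg _)
      simpa [τ] using hf
    have h2 := h1.neg
    rw [mul_neg_one, neg_neg] at h2
    exact h2
  simpa using hg.conj_conj

/-- **The mirrored uniformiser** `z ↦ τ (Ψ_r (τ z))` of the half-disc: `0 ↦ ∞`, `-r ↦ 0`. [folklore] -/
def PsiNeg (r : ℝ) (hr : 0 < r ∧ r < 1) : ConformalEquiv HD upperHalfPlaneSet where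
  toFun z := τ (PsiCE r hr (τ z))
  invFun w := τ ((PsiCE r hr).symm (τ w))
  source := HD
  target := upperHalfPlaneSet
  map_source' z hz := τ_mem_upperHalfPlane_iff.2 ((PsiCE r hr).mapsTo (τ_mem_HD hz))
  map_target' w hw := τ_mem_HD ((PsiCE r hr).symm.mapsTo (τ_mem_upperHalfPlane_iff.2 hw))
  left_inv' z hz := by
    show τ ((PsiCE r hr).symm (τ (τ (PsiCE r hr (τ z))))) = z
    rw [τ_τ, (PsiCE r hr).symm_apply_apply (τ_mem_HD hz), τ_τ]
  right_inv' w hw := by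
    show τ (PsiCE r hr (τ (τ ((PsiCE r hr).symm (τ w))))) = w
    rw [τ_τ, (PsiCE r hr).apply_symm_apply (τ_mem_upperHalfPlane_iff.2 hw), τ_τ]
  source_eq := rfl
  target_eq := rfl
  differentiableOn z hz :=
    (differentiableAt_τ_comp ((PsiCE r hr).differentiableOn.differentiableAt
      (isOpen_HD.mem_nhds (τ_mem_HD hz)))).differentiableWithinAt
  differentiableOn_symm w hw :=
    (differentiableAt_τ_comp ((PsiCE r hr).symm.differentiableOn.differentiableAt
      (UpperHalfPlane.isOpen_upperHalfPlaneSet.mem_nhds (τ_mem_upperHalfPlane_iff.2 hw)))).differentiableWithinAt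

/-- `PsiNeg r z = τ (Ψ_r (τ z))`. [folklore] -/
@[simp] theorem PsiNeg_apply (r : ℝ) (hr : 0 < r ∧ r < 1) (z : ℂ) : PsiNeg r hr z = τ (PsiCE r hr (τ z)) := rfl

/-- `τ` tends to `τ p` within the half-disc. [folklore] -/
theorem tendsto_τ_nhdsWithin_HD (p : ℂ) : Tendsto τ (𝓝[HD] p) (𝓝[HD] (τ p)) :=
  (continuous_τ.continuousWithinAt).tendsto_nhdsWithin fun _ hz => τ_mem_HD hz

/-- **The mirrored uniformiser blows up at `0`.** [folklore] -/
theorem tendsto_norm_PsiNeg {r : ℝ} (hr : 0 < r ∧ r < 1) :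
    Tendsto (fun x => ‖PsiNeg r hr x‖) (𝓝[HD] (0 : ℂ)) atTop := by
  have h := (tendsto_norm_PsiCE hr).comp (by simpa using tendsto_τ_nhdsWithin_HD (0 : ℂ))
  refine h.congr fun x => ?_
  simp

/-- **The mirrored uniformiser vanishes at `-r`.** [folklore] -/
theorem tendsto_PsiNeg_neg {r : ℝ} (hr : 0 < r ∧ r < 1) :
    (PsiNeg r hr).HasBoundaryValue ((-r : ℝ) : ℂ) 0 := by
  unfold ConformalEquiv.HasBoundaryValue
  have hτ : Tendsto τ (𝓝[HD] ((-r : ℝ) : ℂ)) (𝓝[HD] (r : ℂ)) := by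
    have := tendsto_τ_nhdsWithin_HD ((-r : ℝ) : ℂ)
    rw [τ_ofReal] at this
    simp only [Complex.ofReal_neg, neg_neg] at this ⊢
    exact this
  have h0 : Tendsto (PsiCE r hr) (𝓝[HD] (r : ℂ)) (𝓝 0) := tendsto_PsiCE_r hr
  have := (continuous_τ.tendsto 0).comp (h0.comp hτ)
  rw [τ_zero] at this
  exact this

/-- The mirrored logarithm `conj ∘ M_r ∘ τ`. [folklore] -/
def MfunNeg (r : ℝ) (z : ℂ) : ℂ := (starRingEnd ℂ) (Mfun r (τ z))

/-- **`exp (conj (M_r (τ z))) = (PsiNeg)' z` on the half-disc.** [folklore] -/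
theorem exp_MfunNeg {r : ℝ} (hr : 0 < r ∧ r < 1) {z : ℂ} (hz : z ∈ HD) :
    Complex.exp (MfunNeg r z) = deriv (PsiNeg r hr) z := by
  have hd : HasDerivAt (PsiCE r hr) (deriv (PsiCE r hr) (τ z)) (τ z) :=
    ((PsiCE r hr).differentiableOn.differentiableAt (isOpen_HD.mem_nhds (τ_mem_HD hz))).hasDerivAt
  have h := hasDerivAt_τ_comp hd
  rw [show (fun z => τ (PsiCE r hr (τ z))) = (PsiNeg r hr : ℂ → ℂ) from rfl] at h
  rw [h.deriv, MfunNeg, Complex.exp_conj, exp_Mfun hr (τ_mem_HD hz)]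

/-- **Continuity of the mirrored logarithm on the half-disc.** [folklore] -/
theorem continuousOn_MfunNeg {r : ℝ} (hr : 0 < r ∧ r < 1) : ContinuousOn (MfunNeg r) HD := by
  refine Complex.continuous_conj.comp_continuousOn ((continuousOn_Mfun hr).comp continuous_τ.continuousOn ?_)
  exact fun z hz => τ_mem_HD hz

/-- **The mirrored logarithm has the boundary value `conj (M_r r)` at `-r`.** [folklore] -/
theorem tendsto_MfunNeg {r : ℝ} (hr : 0 < r ∧ r < 1) :
    Tendsto (MfunNeg r) (𝓝[HD] ((-r : ℝ) : ℂ)) (𝓝 ((starRingEnd ℂ) (Mfun r r))) := by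
  have hτ : Tendsto τ (𝓝[HD] ((-r : ℝ) : ℂ)) (𝓝[HD] (r : ℂ)) := by
    have := tendsto_τ_nhdsWithin_HD ((-r : ℝ) : ℂ)
    rw [τ_ofReal] at this
    simp only [Complex.ofReal_neg, neg_neg] at this ⊢
    exact this
  exact (Complex.continuous_conj.tendsto _).comp ((tendsto_Mfun_r hr).comp hτ)

end Summit.CriticalPhenomena.SAWScalingLimit.Theorems.HexObservableLimitR.Negative
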